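/-
Copyright (c) 2026 the pub-hodgecm-mathlib formalisation cell (harness21).  Prover seat hodgecm-mathlib-A-p16 (g29), architect of road «S3-tree»
(ruling A-57 (a) S-a), 2026-09-01.
-/
import Literature.NumberTheory.Automorphic.UnitaryLatticeTreeTypes       -- ★ T1b-2 (B-p14 (g35)): `dualLatt_dualLatt_latt`, `latt_le_dualLatt_latt_iff`, `scaleLattice_dualLatt_latt_le_iff`, `dualLatt_scaleLattice`, `mem_scaleLattice_iff`
import Literature.NumberTheory.Automorphic.UnitaryLatticeTreeApartment   -- ★ T1b (B-p14 (g35)): `dualLatt_mapGL`, `mem_mapGL_iff`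
import Literature.NumberTheory.Automorphic.UnitaryLatticeTreeFramed      -- A-p16 (g29) S-a FILE 0: `exists_eq_latt_of_latt_le_of_le_latt`
import HarnessLib

/-!
# A unitary element stabilising a lattice stabilises a VERTEX lattice (the fixed-vertex lemma of the `U(N)` lattice tree, I: the integral-hull descent;
# Bruhat–Tits 1972 §10 / Serre, *Trees* II.1.3)

Topic `NumberTheory/Automorphic`; namespace `Literature.NumberTheory.Automorphic.UnitaryLatticeTree`.  THEOREMS ONLY (no definition, no instance, no notation, no
named fact, no `sorry`); kernel lane.  Cell `pub/hodgecm-mathlib` (D-0151), crux H413 = `stmt-HodgeConjecture-24833`, road «S3-tree» (LEAD F0P3a-plan (g11) WORD T10-2),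
END CONTRACT (F0P3a-p03 (g14), v2 8bf60abf) stub «SPAN», architect ruling A-57 (a) brick **S-a «VERTEX-FIXING»**, FILE 1 (FILE 0 = ★∕filed `UnitaryLatticeTreeFramed`).
WHY: in «SPAN» the conjugacy classes of `U(H′)(L⁺_v)` matched with a `γ_H` near `1` consist of elements with INTEGRAL characteristic polynomial; this file shows that
every such element stabilises a vertex of the lattice tree of ★ T1a `UnitaryLatticeTreeDefs`, i.e. lies in a vertex stabiliser — so a test function can be cut into
pieces supported in vertex stabilisers.
HONEST LABEL: HC_CM is proved only modulo the printed citations until rung 0 closes; this file is elementary lattice algebra over a principal valuation ring and pays no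
letter.

THE MATHEMATICS.  `K` a field with `Valued K ℤᵐ⁰`, `𝒪 = 𝒪[K]` a principal ideal ring, `σ` an involution of `K` preserving `v`, `ϖ` ANY uniformiser (`σ`-fixed or not: unramified AND ramified places), `H` an
invertible hermitian matrix (`(σH)ᵀ = H`), `D(M) = M^♯` the dual lattice.  For a framed lattice `M = latt g` write `e(M)` for the least `e` with `ϖ^e M^♯ ≤ M`.
(§1) bookkeeping on `scaleLattice` and `dualLatt` (`D(A ⊔ B) = D A ⊓ D B`; monotonicity; `c·M ≤ M ≤ c⁻¹·M` for integral `c`; powers of `ϖ` eventually integralise a matrix).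
(§2) THE DESCENT STEP: if `M = latt g` is integral (`M ≤ M^♯`), `δ`-stable for a unitary `δ`, and `ϖ^e M^♯ ≤ M` with `e ≥ 2`, then `M′ := M + ϖ^{e−1}M^♯` is framed (FILE 0:
`M ≤ M′ ≤ M^♯ = latt(gG⁻¹)`), integral (`D M′ = M^♯ ⊓ ϖ^{1−e}M ⊇ M′` because `ϖ^{2e−2}M^♯ ≤ ϖ^e M^♯ ≤ M`), `δ`-stable (`D` and scaling commute with unitary translation, ★
`dualLatt_mapGL`), and `ϖ^{e−1} D M′ ≤ ϖ^{e−1}M^♯ ≤ M′` — the defect drops.  (§3) Induction on `e`: at `e ≤ 1` the lattice is a vertex (`G` and `ϖG⁻¹` integral; the type `d` is read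
off `v(det G) = v(ϖ)^d`), so **a unitary `δ` stabilising some framed lattice stabilises a vertex lattice** (`exists_isVertex_mapGL_eq_of_mapGL_latt_eq`; first scale `latt g₀` by a power
of `ϖ` to make it integral).  (Sequel `UnitaryLatticeTreeFixedVertexCharpoly`: an element whose characteristic polynomial has integral coefficients and unit constant term stabilises the
framed lattice `Σ_{i<N} δ^i·𝒪^N`, whence the head for unitary `δ` with integral characteristic polynomial.)

* §1 `scaleLattice_mono`, `scaleLattice_scaleLattice`, `scaleLattice_le_self_of_v_le_one`, `le_scaleLattice_inv_of_v_le_one`, `scaleLattice_eq_of_v_eq`, `dualLatt_sup`,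
  `exists_isIntMatrix_pow_smul`, `exists_nat_v_det_eq_v_pow`.
* §2 `descent_step` (the four properties of `M + ϖ^{e−1}M^♯`).
* §3 **`exists_isVertex_mapGL_eq_of_integral`** (induction on `e`), **`exists_isVertex_mapGL_eq_of_mapGL_latt_eq`**.

## References
* [BruhatTits1972] F. Bruhat, J. Tits, *Groupes réductifs sur un corps local I*, Publ. Math. IHÉS 41 (1972): §10 (lattice models; a compact element fixes a vertex).
* [Serre1980Trees] J.-P. Serre, *Trees* (1980): Ch. II §1.3 (an element of `GL₂` with integral characteristic polynomial and unit determinant fixes a vertex).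
* [Jacobowitz1962] R. Jacobowitz, *Hermitian forms over local fields*, Amer. J. Math. 84 (1962): §4, §7–§8 (dual lattices, modular lattices).
-/

set_option autoImplicit false

noncomputable section

open scoped Valued WithZero Matrix MatrixGroups

namespace Literature.NumberTheory.Automorphic.UnitaryLatticeTree

open Literature.NumberTheory.Automorphic Literature.NumberTheory.Automorphic.HermitianLattice
open Literature.NumberTheory.Automorphic.CartanUnique

variable {K : Type*} [Field K] [Valued K ℤᵐ⁰] {N : ℕ}

/-! ## §1 Bookkeeping: scaling, duals of sums, integralising by powers of `ϖ` -/

/-- Scaling is monotone. [cite: Serre1980Trees, II.1.1] -/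
theorem scaleLattice_mono (c : K) {A B : Submodule 𝒪[K] (Fin N → K)} (h : A ≤ B) : scaleLattice c A ≤ scaleLattice c B :=
  Submodule.map_mono h

/-- `a·(b·M) = (ab)·M`. [cite: Serre1980Trees, II.1.1] -/
theorem scaleLattice_scaleLattice (a b : K) (M : Submodule 𝒪[K] (Fin N → K)) : scaleLattice a (scaleLattice b M) = scaleLattice (a * b) M := by
  rw [scaleLattice, scaleLattice, scaleLattice, ← Submodule.map_comp]
  congr 1
  apply LinearMap.ext
  intro x
  simp [smul_smul]

/-- `1·M = M` (a `private` twin of ★ `UnitaryLatticeTreeTypeTwoParent.scaleLattice_one`, kept local to avoid the import). [cite: Serre1980Trees, II.1.1] -/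
private theorem scaleLattice_one' (M : Submodule 𝒪[K] (Fin N → K)) : scaleLattice (1 : K) M = M := by
  rw [scaleLattice]
  convert Submodule.map_id M
  apply LinearMap.ext
  intro x
  simp

/-- An integral scalar shrinks a lattice: `c·M ≤ M` for `|c| ≤ 1`. [cite: Serre1980Trees, II.1.1] -/
theorem scaleLattice_le_self_of_v_le_one {c : K} (hc : Valued.v c ≤ 1) (M : Submodule 𝒪[K] (Fin N → K)) : scaleLattice c M ≤ M := by
  rintro _ ⟨x, hx, rfl⟩
  exact smul_mem_of_v_le M hc hx

/-- `M ≤ c⁻¹·M` for an integral `c ≠ 0`. [cite: Serre1980Trees, II.1.1] -/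
theorem le_scaleLattice_inv_of_v_le_one {c : K} (hc0 : c ≠ 0) (hc : Valued.v c ≤ 1) (M : Submodule 𝒪[K] (Fin N → K)) : M ≤ scaleLattice c⁻¹ M := by
  intro x hx
  rw [mem_scaleLattice_iff (inv_ne_zero hc0), inv_inv]
  exact smul_mem_of_v_le M hc hx

/-- Scaling depends only on the valuation of the scalar: `a·M = b·M` when `|a| = |b|` (`a ≠ 0`). [cite: Serre1980Trees, II.1.1] -/
theorem scaleLattice_eq_of_v_eq {a b : K} (ha : a ≠ 0) (h : Valued.v a = Valued.v b) (M : Submodule 𝒪[K] (Fin N → K)) : scaleLattice a M = scaleLattice b M := by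
  have hb : b ≠ 0 := fun h0 => by rw [h0, map_zero] at h; exact (Valuation.ne_zero_iff _).2 ha h
  have hab : Valued.v (a * b⁻¹) ≤ 1 := by rw [map_mul, map_inv₀, h, mul_inv_cancel₀ ((Valuation.ne_zero_iff _).2 hb)]
  have hba : Valued.v (b * a⁻¹) ≤ 1 := by rw [map_mul, map_inv₀, ← h, mul_inv_cancel₀ ((Valuation.ne_zero_iff _).2 ha)]
  refine le_antisymm ?_ ?_
  · intro x hx
    rw [mem_scaleLattice_iff ha] at hx
    rw [mem_scaleLattice_iff hb]
    have : b⁻¹ • x = (a * b⁻¹) • (a⁻¹ • x) := by rw [smul_smul, mul_assoc, mul_comm b⁻¹, ← mul_assoc, mul_inv_cancel₀ ha, one_mul]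
    rw [this]; exact smul_mem_of_v_le M hab hx
  · intro x hx
    rw [mem_scaleLattice_iff hb] at hx
    rw [mem_scaleLattice_iff ha]
    have : a⁻¹ • x = (b * a⁻¹) • (b⁻¹ • x) := by rw [smul_smul, mul_assoc, mul_comm a⁻¹, ← mul_assoc, mul_inv_cancel₀ hb, one_mul]
    rw [this]; exact smul_mem_of_v_le M hba hx

/-- **The dual of a sum is the intersection of the duals**: `(A + B)^♯ = A^♯ ⊓ B^♯`. [cite: Jacobowitz1962, §4] -/
theorem dualLatt_sup (σ : K →+* K) (H : Matrix (Fin N) (Fin N) K) (A B : Submodule 𝒪[K] (Fin N → K)) :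
    dualLatt σ H (A ⊔ B) = dualLatt σ H A ⊓ dualLatt σ H B := by
  refine le_antisymm (le_inf (dualLatt_antitone σ H le_sup_left) (dualLatt_antitone σ H le_sup_right)) ?_
  rintro x ⟨hA, hB⟩ y hy
  obtain ⟨a, ha, b, hb, rfl⟩ := Submodule.mem_sup.1 hy
  rw [map_add, LinearMap.add_apply]
  exact (Valuation.map_add _ _ _).trans (max_le (hA a ha) (hB b hb))

/-- **Powers of a topologically nilpotent `ϖ` integralise any matrix**: `∃ m, ϖ^m • A` is integral (`|ϖ| = exp(−1)`). [cite: Serre1980Trees, II.1.1] -/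
theorem exists_isIntMatrix_pow_smul {ϖ : K} (hϖ : Valued.v ϖ = WithZero.exp (-1 : ℤ)) (A : Matrix (Fin N) (Fin N) K) : ∃ m : ℕ, IsIntMatrix (ϖ ^ m • A) := by
  classical
  -- one exponent per entry
  have hentry : ∀ x : K, ∃ m : ℕ, ∀ m', m ≤ m' → Valued.v (ϖ ^ m' * x) ≤ 1 := by
    intro x
    by_cases hx : x = 0
    · exact ⟨0, fun m' _ => by rw [hx, mul_zero, map_zero]; exact zero_le⟩
    · have hvx : Valued.v x ≠ 0 := (Valuation.ne_zero_iff _).2 hx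
      refine ⟨(WithZero.log (Valued.v x)).toNat, fun m' hm' => ?_⟩
      rw [map_mul, map_pow, hϖ, ← WithZero.exp_nsmul, ← WithZero.exp_log hvx, ← WithZero.exp_add, ← WithZero.exp_zero, WithZero.exp_le_exp]
      simp only [nsmul_eq_mul, mul_neg, mul_one]
      have := Int.self_le_toNat (WithZero.log (Valued.v x))
      omega
  choose m hm using hentry
  refine ⟨Finset.univ.sup fun p : Fin N × Fin N => m (A p.1 p.2), fun i j => ?_⟩
  rw [Matrix.smul_apply, smul_eq_mul]
  exact hm (A i j) _ (Finset.le_sup (f := fun p : Fin N × Fin N => m (A p.1 p.2)) (Finset.mem_univ (i, j)))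

/-- The valuation of a non-zero integral element is `|ϖ|^d` for some `d : ℕ` (`ϖ` a uniformiser). [cite: Serre1980Trees, II.1.1] -/
theorem exists_nat_v_eq_v_pow {ϖ : K} (hϖ : Valued.v ϖ = WithZero.exp (-1 : ℤ)) {x : K} (hx0 : x ≠ 0) (hx : Valued.v x ≤ 1) : ∃ d : ℕ, Valued.v x = Valued.v ϖ ^ d := by
  have hvx : Valued.v x ≠ 0 := (Valuation.ne_zero_iff _).2 hx0
  have h0 : WithZero.log (Valued.v x) ≤ 0 := by
    rw [← WithZero.exp_log hvx, ← WithZero.exp_zero, WithZero.exp_le_exp] at hx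
    exact hx
  have hx' : Valued.v x = WithZero.exp (WithZero.log (Valued.v x)) := (WithZero.exp_log hvx).symm
  refine ⟨(-WithZero.log (Valued.v x)).toNat, ?_⟩
  rw [hϖ, ← WithZero.exp_nsmul]
  conv_lhs => rw [hx']
  congr 1
  simp only [nsmul_eq_mul, mul_neg, mul_one]
  omega


/-! ## §2 The descent step `M ↦ M + ϖ^{e−1}M^♯` -/

section Descent

variable [IsPrincipalIdealRing 𝒪[K]] (σ : K →+* K) (hσ : ∀ a, σ (σ a) = a) (hvσ : ∀ a, Valued.v (σ a) = Valued.v a)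
  {ϖ : K} (hϖ : Valued.v ϖ = WithZero.exp (-1 : ℤ))
  {H : Matrix (Fin N) (Fin N) K} (hH : IsUnit H.det) (hHh : (H.map σ)ᵀ = H)

omit [IsPrincipalIdealRing 𝒪[K]] in
include hϖ in
/-- `ϖ ≠ 0`. [cite: Serre1980Trees, II.1.1] -/
private theorem ϖ_ne_zero' : ϖ ≠ 0 := fun h => by
  rw [h, map_zero] at hϖ; exact WithZero.coe_ne_zero hϖ.symm

omit [IsPrincipalIdealRing 𝒪[K]] in
include hϖ in
/-- `|ϖ^k| ≤ 1`. [cite: Serre1980Trees, II.1.1] -/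
private theorem v_pow_le_one' (k : ℕ) : Valued.v (ϖ ^ k) ≤ 1 := by
  rw [map_pow, hϖ, ← WithZero.exp_nsmul, ← WithZero.exp_zero, WithZero.exp_le_exp]
  simp only [nsmul_eq_mul, mul_neg, mul_one, Left.neg_nonpos_iff]
  exact_mod_cast Nat.zero_le k

include hσ hvσ hϖ hH hHh in
/-- **THE DESCENT STEP.**  `M = latt g` integral (`M ≤ M^♯`), stable under a unitary `δ`, with `ϖ^e M^♯ ≤ M`, `e ≥ 2`.  Then `M′ := M + ϖ^{e−1} M^♯` is framed
(`M ≤ M′ ≤ M^♯ = latt (gG⁻¹)`, FILE 0), integral (`(M′)^♯ = M^♯ ⊓ ϖ^{1−e}M` contains `M′` since `ϖ^{2e−2}M^♯ ≤ M`), `δ`-stable (duality and scaling commute with a unitary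
translation) and `ϖ^{e−1}(M′)^♯ ≤ ϖ^{e−1}M^♯ ≤ M′`: the defect drops by one. [cite: BruhatTits1972, §10] [cite: Jacobowitz1962, §7–§8] -/
theorem descent_step {δ : GL (Fin N) K} (hδ : δ ∈ unitaryGroupOfForm σ H) (g : GL (Fin N) K)
    (hint : latt (g : Matrix (Fin N) (Fin N) K) ≤ dualLatt σ H (latt (g : Matrix (Fin N) (Fin N) K))) {e : ℕ} (he : 2 ≤ e)
    (hle : scaleLattice (ϖ ^ e) (dualLatt σ H (latt (g : Matrix (Fin N) (Fin N) K))) ≤ latt (g : Matrix (Fin N) (Fin N) K))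
    (hfix : mapGL δ (latt (g : Matrix (Fin N) (Fin N) K)) = latt (g : Matrix (Fin N) (Fin N) K)) :
    ∃ g' : GL (Fin N) K,
      latt (g' : Matrix (Fin N) (Fin N) K) ≤ dualLatt σ H (latt (g' : Matrix (Fin N) (Fin N) K)) ∧
      scaleLattice (ϖ ^ (e - 1)) (dualLatt σ H (latt (g' : Matrix (Fin N) (Fin N) K))) ≤ latt (g' : Matrix (Fin N) (Fin N) K) ∧
      mapGL δ (latt (g' : Matrix (Fin N) (Fin N) K)) = latt (g' : Matrix (Fin N) (Fin N) K) := by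
  have hϖ0 : ϖ ≠ 0 := ϖ_ne_zero' hϖ
  set M : Submodule 𝒪[K] (Fin N → K) := latt (g : Matrix (Fin N) (Fin N) K) with hM
  set c : K := ϖ ^ (e - 1) with hc
  have hc0 : c ≠ 0 := pow_ne_zero _ hϖ0
  have hc1 : Valued.v c ≤ 1 := v_pow_le_one' hϖ _
  have hσc : Valued.v (σ c)⁻¹ = Valued.v c⁻¹ := by rw [map_inv₀, map_inv₀, hvσ]
  -- the new lattice
  set M' : Submodule 𝒪[K] (Fin N → K) := M ⊔ scaleLattice c (dualLatt σ H M) with hM'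
  -- framing: `M ≤ M' ≤ M^♯ = latt (g G⁻¹)`
  have hMM' : M ≤ M' := le_sup_left
  have hM'D : M' ≤ dualLatt σ H M := sup_le hint (scaleLattice_le_self_of_v_le_one hc1 _)
  have hGu : IsUnit ((g : Matrix (Fin N) (Fin N) K) * (formCongr σ g H)⁻¹).det := by
    rw [Matrix.det_mul]
    refine (Matrix.isUnits_det_units g).mul (Matrix.isUnit_nonsing_inv_det_iff.2 ?_)
    change IsUnit (((g : Matrix (Fin N) (Fin N) K).map σ)ᵀ * H * (g : Matrix (Fin N) (Fin N) K)).det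
    rw [Matrix.det_mul, Matrix.det_mul]
    exact ((isUnit_det_transpose_map σ (Matrix.isUnits_det_units g)).mul hH).mul (Matrix.isUnits_det_units g)
  obtain ⟨b, hb⟩ : ∃ b : GL (Fin N) K, (b : Matrix (Fin N) (Fin N) K) = (g : Matrix (Fin N) (Fin N) K) * (formCongr σ g H)⁻¹ :=
    ⟨((Matrix.isUnit_iff_isUnit_det _).2 hGu).unit, by simp⟩
  have hDM : dualLatt σ H M = latt (b : Matrix (Fin N) (Fin N) K) := by rw [hb, hM, dualLatt_latt σ hvσ hH g]
  obtain ⟨g', hg'⟩ := exists_eq_latt_of_latt_le_of_le_latt g b M' hMM' (by rw [← hDM]; exact hM'D)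
  refine ⟨g', ?_, ?_, ?_⟩
  all_goals rw [← hg']
  · -- integrality: `(M')^♯ = M^♯ ⊓ c⁻¹ M ⊇ M'`
    have hD : dualLatt σ H M' = dualLatt σ H M ⊓ scaleLattice c⁻¹ M := by
      rw [hM', dualLatt_sup, dualLatt_scaleLattice σ H hc0, scaleLattice_eq_of_v_eq (inv_ne_zero ((map_ne_zero σ).2 hc0)) hσc, hM,
        dualLatt_dualLatt_latt σ hσ hvσ hH hHh (Matrix.isUnits_det_units g)]
    rw [hD]
    refine le_inf hM'D (sup_le (le_scaleLattice_inv_of_v_le_one hc0 hc1 M) ?_)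
    -- `c·M^♯ ≤ c⁻¹·M` since `c²·M^♯ = ϖ^{e-2}·(ϖ^e·M^♯) ≤ M`
    intro x hx
    rw [mem_scaleLattice_iff (inv_ne_zero hc0), inv_inv]
    have hx2 : c • x ∈ scaleLattice (c * c) (dualLatt σ H M) := by
      rw [← scaleLattice_scaleLattice]; exact ⟨x, hx, rfl⟩
    have hcc : c * c = ϖ ^ (e - 2) * ϖ ^ e := by rw [hc, ← pow_add, ← pow_add]; congr 1; omega
    rw [hcc, ← scaleLattice_scaleLattice] at hx2
    exact scaleLattice_le_self_of_v_le_one (v_pow_le_one' hϖ _) _ (scaleLattice_mono _ hle hx2)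
  · -- the defect drops: `c·(M')^♯ ≤ c·M^♯ ≤ M'`
    exact (scaleLattice_mono c (dualLatt_antitone σ H hMM')).trans le_sup_right
  · -- `δ`-stability
    rw [hM', mapGL, Submodule.map_sup, ← mapGL, ← mapGL, hM, hfix, mapGL_scaleLattice, ← dualLatt_mapGL hδ, hfix]

end Descent


/-! ## §3 Induction on the defect: a unitary element stabilising a framed lattice stabilises a vertex -/

section Vertex

variable [IsPrincipalIdealRing 𝒪[K]] (σ : K →+* K) (hσ : ∀ a, σ (σ a) = a) (hvσ : ∀ a, Valued.v (σ a) = Valued.v a)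
  {ϖ : K} (hϖ : Valued.v ϖ = WithZero.exp (-1 : ℤ))
  {H : Matrix (Fin N) (Fin N) K} (hH : IsUnit H.det) (hHh : (H.map σ)ᵀ = H)

include hσ hvσ hϖ hH hHh in
/-- **INDUCTION ON THE DEFECT.**  If `M = latt g` is integral, `δ`-stable (`δ` unitary) and `ϖ^e M^♯ ≤ M`, then `δ` stabilises a vertex lattice: for `e ≤ 1` the lattice `M`
itself is a vertex (its Gram matrix `G` and `ϖG⁻¹` are integral, the type `d` is read off `v(det G) = v(ϖ)^d`); for `e ≥ 2` apply `descent_step` and recurse.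
[cite: BruhatTits1972, §10] [cite: Serre1980Trees, Ch. II §1.3] -/
theorem exists_isVertex_mapGL_eq_of_integral {δ : GL (Fin N) K} (hδ : δ ∈ unitaryGroupOfForm σ H) (e : ℕ) :
    ∀ g : GL (Fin N) K, latt (g : Matrix (Fin N) (Fin N) K) ≤ dualLatt σ H (latt (g : Matrix (Fin N) (Fin N) K)) →
      scaleLattice (ϖ ^ e) (dualLatt σ H (latt (g : Matrix (Fin N) (Fin N) K))) ≤ latt (g : Matrix (Fin N) (Fin N) K) →
      mapGL δ (latt (g : Matrix (Fin N) (Fin N) K)) = latt (g : Matrix (Fin N) (Fin N) K) →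
      ∃ M : Submodule 𝒪[K] (Fin N → K), IsVertex σ ϖ H M ∧ mapGL δ M = M := by
  have hϖ0 : ϖ ≠ 0 := ϖ_ne_zero' hϖ
  -- the base case, for any `g` with defect `≤ 1`
  have base : ∀ g : GL (Fin N) K, latt (g : Matrix (Fin N) (Fin N) K) ≤ dualLatt σ H (latt (g : Matrix (Fin N) (Fin N) K)) →
      scaleLattice ϖ (dualLatt σ H (latt (g : Matrix (Fin N) (Fin N) K))) ≤ latt (g : Matrix (Fin N) (Fin N) K) →
      mapGL δ (latt (g : Matrix (Fin N) (Fin N) K)) = latt (g : Matrix (Fin N) (Fin N) K) →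
      ∃ M : Submodule 𝒪[K] (Fin N → K), IsVertex σ ϖ H M ∧ mapGL δ M = M := by
    intro g hint h1 hfix
    have hG : IsIntMatrix (formCongr σ g H) := (latt_le_dualLatt_latt_iff σ hvσ H _).1 hint
    have hG' : IsIntMatrix (ϖ • (formCongr σ g H)⁻¹) := (scaleLattice_dualLatt_latt_le_iff σ hvσ hH (Matrix.isUnits_det_units g) ϖ).1 h1
    have hdetU : IsUnit (formCongr σ g H).det := by
      change IsUnit (((g : Matrix (Fin N) (Fin N) K).map σ)ᵀ * H * (g : Matrix (Fin N) (Fin N) K)).det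
      rw [Matrix.det_mul, Matrix.det_mul]
      exact ((isUnit_det_transpose_map σ (Matrix.isUnits_det_units g)).mul hH).mul (Matrix.isUnits_det_units g)
    obtain ⟨d, hd⟩ := exists_nat_v_eq_v_pow hϖ hdetU.ne_zero (v_det_le_one_of_forall_v_le_one hG)
    exact ⟨_, ⟨d, g, rfl, hG, hG', hd⟩, hfix⟩
  induction e with
  | zero =>
    intro g hint hle hfix
    refine base g hint ?_ hfix
    rw [pow_zero, scaleLattice_one'] at hle
    exact (scaleLattice_le_self_of_v_le_one (by rw [hϖ, ← WithZero.exp_zero, WithZero.exp_le_exp]; norm_num) _).trans hle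
  | succ e ih =>
    intro g hint hle hfix
    rcases Nat.eq_zero_or_pos e with he | he
    · subst he
      rw [zero_add, pow_one] at hle
      exact base g hint hle hfix
    · obtain ⟨g', h1, h2, h3⟩ := descent_step σ hσ hvσ hϖ hH hHh hδ g hint (by omega) hle hfix
      rw [Nat.add_sub_cancel] at h2
      exact ih g' h1 h2 h3

include hσ hvσ hϖ hH hHh in
/-- **A UNITARY ELEMENT STABILISING A LATTICE STABILISES A VERTEX LATTICE.**  `δ ∈ U(σ, H)` with `δ·latt g₀ = latt g₀` for some frame `g₀ ∈ GL_N(K)` fixes a vertex of the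
lattice tree: scale `latt g₀` by `ϖ^m` to make its Gram matrix integral (`δ`-stability and framing are preserved), pick `e` with `ϖ^e M^♯ ≤ M`, and run the descent.
[cite: BruhatTits1972, §10] [cite: Serre1980Trees, Ch. II §1.3] -/
theorem exists_isVertex_mapGL_eq_of_mapGL_latt_eq {δ : GL (Fin N) K} (hδ : δ ∈ unitaryGroupOfForm σ H) (g₀ : GL (Fin N) K)
    (hfix : mapGL δ (latt (g₀ : Matrix (Fin N) (Fin N) K)) = latt (g₀ : Matrix (Fin N) (Fin N) K)) :
    ∃ M : Submodule 𝒪[K] (Fin N → K), IsVertex σ ϖ H M ∧ mapGL δ M = M := by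
  have hϖ0 : ϖ ≠ 0 := ϖ_ne_zero' hϖ
  -- integralise: `M := ϖ^m · latt g₀ = latt (g₀ · ϖ^m)`
  obtain ⟨m, hm⟩ := exists_isIntMatrix_pow_smul hϖ (formCongr σ g₀ H)
  have hsU : IsUnit (Matrix.scalar (Fin N) (ϖ ^ m) : Matrix (Fin N) (Fin N) K) :=
    (Matrix.scalar (Fin N)).isUnit_map ((IsUnit.mk0 _ (pow_ne_zero m hϖ0)))
  obtain ⟨s, hs⟩ : ∃ s : GL (Fin N) K, (s : Matrix (Fin N) (Fin N) K) = Matrix.scalar (Fin N) (ϖ ^ m) := ⟨hsU.unit, by simp⟩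
  set g : GL (Fin N) K := g₀ * s with hg
  have hgs : (g : Matrix (Fin N) (Fin N) K) = ϖ ^ m • (g₀ : Matrix (Fin N) (Fin N) K) := by
    rw [hg, Units.val_mul, hs, Matrix.scalar_apply, ← Matrix.smul_one_eq_diagonal, Matrix.mul_smul, Matrix.mul_one]
  have hM : latt (g : Matrix (Fin N) (Fin N) K) = scaleLattice (ϖ ^ m) (latt (g₀ : Matrix (Fin N) (Fin N) K)) := by rw [hgs, scaleLattice_latt]
  -- Gram matrix of the scaled frame: `σ(ϖ)^m ϖ^m G₀`
  have hGram : formCongr σ g H = σ ϖ ^ m • (ϖ ^ m • formCongr σ g₀ H) := by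
    change ((g : Matrix (Fin N) (Fin N) K).map σ)ᵀ * H * (g : Matrix (Fin N) (Fin N) K) =
      σ ϖ ^ m • (ϖ ^ m • (((g₀ : Matrix (Fin N) (Fin N) K).map σ)ᵀ * H * (g₀ : Matrix (Fin N) (Fin N) K)))
    have hmapσ : (ϖ ^ m • (g₀ : Matrix (Fin N) (Fin N) K)).map σ = σ ϖ ^ m • (g₀ : Matrix (Fin N) (Fin N) K).map σ := by
      ext i j
      simp only [Matrix.map_apply, Matrix.smul_apply, smul_eq_mul, map_mul, map_pow]
    rw [hgs, hmapσ, Matrix.transpose_smul, Matrix.smul_mul, Matrix.smul_mul, Matrix.mul_smul]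
  have hint : latt (g : Matrix (Fin N) (Fin N) K) ≤ dualLatt σ H (latt (g : Matrix (Fin N) (Fin N) K)) := by
    rw [latt_le_dualLatt_latt_iff σ hvσ H]
    change IsIntMatrix (formCongr σ g H)
    rw [hGram]
    intro i j
    rw [Matrix.smul_apply, smul_eq_mul, map_mul]
    refine mul_le_one' ?_ (hm i j)
    rw [map_pow, hvσ, ← map_pow]
    exact v_pow_le_one' hϖ m
  -- the defect exists
  have hdetU : IsUnit (formCongr σ g H).det := by
    change IsUnit (((g : Matrix (Fin N) (Fin N) K).map σ)ᵀ * H * (g : Matrix (Fin N) (Fin N) K)).det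
    rw [Matrix.det_mul, Matrix.det_mul]
    exact ((isUnit_det_transpose_map σ (Matrix.isUnits_det_units g)).mul hH).mul (Matrix.isUnits_det_units g)
  obtain ⟨e, he⟩ := exists_isIntMatrix_pow_smul hϖ (formCongr σ g H)⁻¹
  have hle : scaleLattice (ϖ ^ e) (dualLatt σ H (latt (g : Matrix (Fin N) (Fin N) K))) ≤ latt (g : Matrix (Fin N) (Fin N) K) :=
    (scaleLattice_dualLatt_latt_le_iff σ hvσ hH (Matrix.isUnits_det_units g) (ϖ ^ e)).2 he
  -- `δ`-stability survives scaling
  have hfix' : mapGL δ (latt (g : Matrix (Fin N) (Fin N) K)) = latt (g : Matrix (Fin N) (Fin N) K) := by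
    rw [hM, mapGL_scaleLattice, hfix]
  exact exists_isVertex_mapGL_eq_of_integral σ hσ hvσ hϖ hH hHh hδ e g hint hle hfix'

end Vertex

end Literature.NumberTheory.Automorphic.UnitaryLatticeTree

end
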